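import Literature.AlgebraicGeometry.Morphisms.SteinFactorization
import Literature.AlgebraicGeometry.Morphisms.GeometricallyConnectedOfSection
import Mathlib.AlgebraicGeometry.Morphisms.Finite
import Mathlib.RingTheory.AdjoinRoot
import Mathlib.FieldTheory.Minpoly.Field
import Mathlib.RingTheory.Flat.Localization
import HarnessLib

/-!
# Stein factorisation (Stacks Project, Tag 03H2 (1)): reduction to the local connectedness core

Sibling proof file of `Literature/AlgebraicGeometry/Morphisms/SteinFactorization.lean` for the named
fact `Literature.AlgebraicGeometry.Morphisms.steinFactorization_geometricallyConnected` (The Stacks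
Project, Tag 03H2 = More on Morphisms, Theorem 37.53.5 (1) with (5): for `f : X → S` proper, the
morphism `f' : X → S'` to the normalisation of `S` in `X` has geometrically connected fibres).

The printed proof of Tag 03H2 has three layers: (a) Lemma 37.53.1 (Tag 03GY: `f'` proper and
surjective, `S'` affine-locally `Spec Γ(f⁻¹U, 𝒪_X)`) — proved in `SteinFactorization.lean`;
(b) "we may assume `S = Spec R` affine … replace `S` by `S'` … `R = Γ(X, 𝒪_X)` … by Lemma 37.53.3
[Tag 03GZ: étale localisation, via Tags 02LF and 0389] it suffices to show `X_s` connected [after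
étale base change]"; (c) the local core: for `X → Spec R` proper with `R = Γ(X, 𝒪_X)` the fibres
are connected (Derived Categories of Schemes, Lemma 36.32.7 = Tag 0G7X: idempotents on `X_s` lift,
by the theorem on formal functions, Tag 02OC, and Noetherian approximation, Tag 0A0P).

This file PROVES layer (b) — the reduction of the named fact to the local core (c) — in the form

* `steinFactorization_geometricallyConnected_of_localConn`: **if for every local ring `B` and every
  proper `g : Y → Spec B` with `B ≅ Γ(Y, 𝒪_Y)` the closed fibre `Y ×_B κ_B` is preconnected, then
  `steinFactorization_geometricallyConnected` holds**;
* `geometricallyConnected_of_isIso_appTop_of_localConn`: under the same hypothesis every proper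
  `g : Y → Spec B` with `B ≅ Γ(Y, 𝒪_Y)` is geometrically connected (Zariski's connectedness theorem
  in the form of the discussion opening Section 37.53 / EGA III₁ 4.3.2, 4.3.4);

and, more generally, relative to a class `𝒩` of rings (stable under `B ↦ B[T]/(P)`, `P` monic, and
localisation at primes) and a base-change-stable class `𝒞` of morphisms to affine schemes
(`SteinFibre.geometricallyConnected_of_localConn`), so that the same reduction serves restricted
cores (Noetherian rings and projective morphisms: Hartshorne III Cor. 11.3).

Instead of the étale neighbourhoods of Tag 03GZ (Tags 02LF, 0389 are not in Mathlib) the residue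
field is extended by **finite free local base changes** `B ↦ B₁ = B[T]/(P)` (`P` a monic lift of an
irreducible `p ∈ κ_B[T]`; `B₁` is local with residue field `κ_B[T]/(p)`, `SteinFibre.isLocalRing_adjoinRoot`),
which preserve properness and `B ≅ Γ(Y, 𝒪_Y)` (flat base change of `H⁰`, Tag 02KH, Mathlib
`isIso_pushoutSection_of_isQuasiSeparated_of_flat_right`; `SteinFibre.isIso_appTop_pullback_snd_of_flat`):
by induction on the degree this gives the connectedness of `Y ×_B K` for every finite residue
extension `K/κ_B` (`SteinFibre.connectedSpace_pullback_of_finite`); taking `K = κ(x)` for a closed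
point `x` of the (non-empty, finite type, hence Jacobson) closed fibre produces a rational point, so
the closed fibre is geometrically connected by Tag 04KV (the tree's `geometricallyConnected_of_section`)
and descent of geometric connectedness along `κ_B → κ(x)`
(`SteinFibre.geometricallyConnected_closedFibre`); arbitrary points `Spec K → Spec B` are reached
through `B → B_𝔭 → K` (`SteinFibre.geometricallyConnected_of_localConn`), and the named fact
through the affine-local structure of `S'` (`isIso_toNormalization_app`, `isProper_toNormalization`).

Everything here is proved; no named facts are introduced. What remains for
`steinFactorization_geometricallyConnected_holds` is exactly the local core (c): Tag 0G7X for a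
proper scheme over a local ring `B` with `B = Γ(Y, 𝒪_Y)` — the theorem on formal functions
(Tag 02OC) in the Noetherian case and the approximation of proper morphisms (Tags 09ZR, 0A0P) in
general, neither of which is in Mathlib (pin v4.32) or in the tree.

## References

* The Stacks Project, Tag 03H2 (More on Morphisms, Theorem 37.53.5) and its proof; Tag 03GZ
  (Lemma 37.53.3); Tag 0G7X (Derived Categories of Schemes, Lemma 36.32.7); Tag 04KV (Varieties,
  Lemma 33.7.14); Tag 02KH (Cohomology of Schemes, Lemma 30.5.2: flat base change).
* A. Grothendieck, EGA III₁, Théorème 4.3.1, Corollaires 4.3.2–4.3.4.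
* R. Hartshorne, *Algebraic Geometry*, GTM 52 (1977), III Cor. 11.3.
-/

noncomputable section

open CategoryTheory CategoryTheory.Limits AlgebraicGeometry TopologicalSpace
open scoped TensorProduct

universe u

namespace Literature.AlgebraicGeometry.Morphisms

namespace SteinFibre

/-! ### Connectedness along surjections and isomorphisms of schemes -/

/-- The target of a surjective morphism of schemes with connected source is connected. [folklore] -/
theorem connectedSpace_of_surjective {X Y : Scheme.{u}} (p : X ⟶ Y) [Surjective p]
    [ConnectedSpace X] : ConnectedSpace Y := by
  have h : _root_.IsConnected (Set.range p) :=
    isConnected_range p.continuous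
  rw [p.surjective.range_eq] at h
  exact connectedSpace_iff_univ.mpr h

/-- Connectedness is invariant under isomorphisms of schemes. [folklore] -/
theorem connectedSpace_of_iso {X Y : Scheme.{u}} (e : X ≅ Y) [ConnectedSpace X] : ConnectedSpace Y :=
  connectedSpace_of_surjective e.hom

/-! ### A common extension of two field extensions -/

/-- Two field extensions `k → k'`, `k → K` embed into a common field `L` (a residue field of
`k' ⊗_k K`). [folklore] -/
theorem exists_common_extension {k k' K : Type u} [Field k] [Field k'] [Field K] (φ : k →+* k')
    (ψ : k →+* K) :
    ∃ (L : Type u) (_ : Field L) (α : k' →+* L) (β : K →+* L), α.comp φ = β.comp ψ := by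
  letI := φ.toAlgebra
  letI := ψ.toAlgebra
  have hinj : Function.Injective
      (Algebra.TensorProduct.includeLeft (R := k) (S := k) (A := k') (B := K)) :=
    Algebra.TensorProduct.includeLeft_injective (S := k) (algebraMap k K).injective
  haveI : Nontrivial (k' ⊗[k] K) := hinj.nontrivial
  obtain ⟨M, hM⟩ := Ideal.exists_maximal (k' ⊗[k] K)
  letI : Field ((k' ⊗[k] K) ⧸ M) := Ideal.Quotient.field M
  refine ⟨(k' ⊗[k] K) ⧸ M, inferInstance,
    (Ideal.Quotient.mk M).comp (Algebra.TensorProduct.includeLeft (S := k) : k' →ₐ[k] k' ⊗[k] K),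
    (Ideal.Quotient.mk M).comp (Algebra.TensorProduct.includeRight : K →ₐ[k] k' ⊗[k] K), ?_⟩
  ext a
  change Ideal.Quotient.mk M (Algebra.TensorProduct.includeLeft (S := k) (algebraMap k k' a)) =
    Ideal.Quotient.mk M (Algebra.TensorProduct.includeRight (algebraMap k K a))
  rw [AlgHom.commutes, AlgHom.commutes]

/-! ### Descent of geometric connectedness along a field extension -/

/-- **Geometric connectedness descends along field extensions.** Let `g : T → Spec k` and let
`k → k'` be a field extension. If the base change `T_{k'} → Spec k'` is geometrically connected,
so is `g`: for a field `K/k` choose a common extension `L` of `k'` and `K`; then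
`T_L = (T_{k'})_L` is connected and `T_L → T_K` is surjective. [folklore] -/
theorem geometricallyConnected_of_geometricallyConnected_baseChange {k k' : Type u} [Field k]
    [Field k'] {T : Scheme.{u}} (g : T ⟶ Spec (.of k)) (φ : k →+* k')
    (h : GeometricallyConnected (pullback.snd g (Spec.map (CommRingCat.ofHom φ)))) :
    GeometricallyConnected g := by
  refine ⟨(geometrically_iff_of_commRing_of_isClosedUnderIsomorphisms
    (P := fun X : Scheme.{u} ↦ ConnectedSpace X)).mpr fun K _ _ ↦ ?_⟩
  obtain ⟨L, _, α, β, hαβ⟩ := exists_common_extension φ (algebraMap k K)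
  -- `T_L = (T_{k'})_L` is connected
  have hL : ConnectedSpace
      ↥(pullback (pullback.snd g (Spec.map (CommRingCat.ofHom φ))) (Spec.map (CommRingCat.ofHom α))) :=
    h.geometrically_connectedSpace _ _ _ (.of_hasPullback _ _)
  have e₁ : pullback (pullback.snd g (Spec.map (CommRingCat.ofHom φ))) (Spec.map (CommRingCat.ofHom α)) ≅
      pullback g (Spec.map (CommRingCat.ofHom α) ≫ Spec.map (CommRingCat.ofHom φ)) :=
    pullbackLeftPullbackSndIso _ _ _
  have hcomp : Spec.map (CommRingCat.ofHom α) ≫ Spec.map (CommRingCat.ofHom φ) =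
      Spec.map (CommRingCat.ofHom β) ≫ Spec.map (CommRingCat.ofHom (algebraMap k K)) := by
    rw [← Spec.map_comp, ← Spec.map_comp, ← CommRingCat.ofHom_comp, ← CommRingCat.ofHom_comp, hαβ]
  have e₂ : pullback g (Spec.map (CommRingCat.ofHom α) ≫ Spec.map (CommRingCat.ofHom φ)) ≅
      pullback g (Spec.map (CommRingCat.ofHom β) ≫ Spec.map (CommRingCat.ofHom (algebraMap k K))) :=
    pullback.congrHom rfl hcomp
  have e₃ : pullback g (Spec.map (CommRingCat.ofHom β) ≫ Spec.map (CommRingCat.ofHom (algebraMap k K))) ≅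
      pullback (pullback.snd g (Spec.map (CommRingCat.ofHom (algebraMap k K))))
        (Spec.map (CommRingCat.ofHom β)) :=
    (pullbackLeftPullbackSndIso _ _ _).symm
  haveI := hL
  haveI : ConnectedSpace ↥(pullback (pullback.snd g (Spec.map (CommRingCat.ofHom (algebraMap k K))))
      (Spec.map (CommRingCat.ofHom β))) :=
    connectedSpace_of_iso (e₁ ≪≫ e₂ ≪≫ e₃)
  -- and `T_L → T_K` is surjective (a base change of `Spec L → Spec K`)
  haveI : Surjective (Spec.map (CommRingCat.ofHom β)) :=
    ⟨fun x ↦ ⟨Classical.arbitrary _, Subsingleton.elim _ _⟩⟩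
  exact connectedSpace_of_surjective
    (pullback.fst (pullback.snd g (Spec.map (CommRingCat.ofHom (algebraMap k K))))
      (Spec.map (CommRingCat.ofHom β)))


/-! ### Flat affine base change of the ring of global functions -/

/-- **Flat base change of `H⁰`** (Stacks Project, Tag 02KH, for global sections): for
`g : Y → Spec B` with `Y` quasi-compact and quasi-separated and a flat ring map `φ : B → B'`,
if `B = Γ(Spec B, 𝒪) → Γ(Y, 𝒪_Y)` is an isomorphism then so is
`B' → Γ(Y ×_B B', 𝒪)` (the square of global sections is a pushout, Mathlib
`isIso_pushoutSection_of_isQuasiSeparated_of_flat_right`, and a pushout of an isomorphism is an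
isomorphism). [cite: StacksProject, Tag 02KH (Cohomology of Schemes, Lemma 30.5.2: flat base change)] -/
theorem isIso_appTop_pullback_snd_of_flat {B B' : Type u} [CommRing B] [CommRing B']
    {Y : Scheme.{u}} (g : Y ⟶ Spec (.of B)) [CompactSpace Y] [QuasiSeparatedSpace Y]
    (φ : B →+* B') (hφ : φ.Flat) [IsIso g.appTop] :
    IsIso (pullback.snd g (Spec.map (CommRingCat.ofHom φ))).appTop := by
  haveI : Flat (Spec.map (CommRingCat.ofHom φ)) := Flat.SpecMap_iff.mpr hφ
  have h := IsPullback.of_hasPullback g (Spec.map (CommRingCat.ofHom φ))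
  have hiso := isIso_pushoutSection_of_isQuasiSeparated_of_flat_right h
    (US := ⊤) (UT := ⊤) (UX := ⊤) (UY := ⊤) le_top le_top (by simp) (isAffineOpen_top _)
    (isAffineOpen_top _) isCompact_univ isQuasiSeparated_univ
  have hinr : pushout.inr _ _ ≫ pushoutSection h (US := ⊤) (UT := ⊤) (UX := ⊤) (UY := ⊤)
      le_top le_top (by simp) =
      (pullback.snd g (Spec.map (CommRingCat.ofHom φ))).appLE ⊤ ⊤ (by simp) :=
    pushout.inr_desc _ _ _
  haveI : IsIso (g.appLE (⊤ : (Spec (.of B)).Opens) ⊤ le_top) := by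
    rw [show g.appLE ⊤ ⊤ le_top = g.appTop from (Scheme.Hom.app_eq_appLE g).symm]
    infer_instance
  haveI : IsIso ((pullback.snd g (Spec.map (CommRingCat.ofHom φ))).appLE
      (⊤ : (Spec (.of B')).Opens) ⊤ (by simp)) := by
    rw [← hinr]; infer_instance
  rw [show (pullback.snd g (Spec.map (CommRingCat.ofHom φ))).appTop =
      (pullback.snd g (Spec.map (CommRingCat.ofHom φ))).appLE ⊤ ⊤ (by simp) from
    Scheme.Hom.app_eq_appLE _]
  infer_instance

/-! ### Monogenic finite free local extensions `B ↦ B[T]/(P)` -/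

section AdjoinRoot

open Polynomial IsLocalRing

variable {B : Type u} [CommRing B] [IsLocalRing B] (P : B[X])

/-- For `B` local and `P ∈ B[T]` monic whose reduction `p ∈ k[T]` modulo the maximal ideal is
irreducible, the ideal `𝔪_B · B[T]/(P)` is maximal: the quotient is `k[T]/(p)`, a field
(Mathlib `AdjoinRoot.quotEquivQuotMap`). [folklore] -/
theorem isMaximal_map_maximalIdeal_adjoinRoot
    (hirr : Irreducible (P.map (residue B))) :
    ((maximalIdeal B).map (AdjoinRoot.of P)).IsMaximal := by
  haveI : Fact (Irreducible (P.map (residue B))) := ⟨hirr⟩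
  have e : (AdjoinRoot P ⧸ (maximalIdeal B).map (AdjoinRoot.of P)) ≃+*
      AdjoinRoot (P.map (Ideal.Quotient.mk (maximalIdeal B))) :=
    (AdjoinRoot.quotEquivQuotMap P (maximalIdeal B)).toRingEquiv
  have hF : IsField (AdjoinRoot P ⧸ (maximalIdeal B).map (AdjoinRoot.of P)) :=
    e.toMulEquiv.isField (Field.toIsField (AdjoinRoot (P.map (residue B))))
  exact Ideal.Quotient.maximal_of_isField _ hF

/-- For `B` local and `P ∈ B[T]` monic with irreducible reduction, `B[T]/(P)` is a local ring
with maximal ideal `𝔪_B · B[T]/(P)`: every maximal ideal of the integral extension `B[T]/(P)`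
contracts to `𝔪_B`, hence contains `𝔪_B · B[T]/(P)`, which is itself maximal. [folklore] -/
theorem isLocalRing_adjoinRoot (hP : P.Monic) (hirr : Irreducible (P.map (residue B))) :
    IsLocalRing (AdjoinRoot P) := by
  have hmax := isMaximal_map_maximalIdeal_adjoinRoot P hirr
  refine IsLocalRing.of_unique_max_ideal ⟨(maximalIdeal B).map (AdjoinRoot.of P), hmax, ?_⟩
  intro M hM
  haveI := hM
  haveI : Module.Finite B (AdjoinRoot P) := (AdjoinRoot.powerBasis' hP).finite
  haveI : Algebra.IsIntegral B (AdjoinRoot P) := Algebra.IsIntegral.of_finite B _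
  have hc : (M.comap (algebraMap B (AdjoinRoot P))).IsMaximal :=
    Ideal.isMaximal_comap_of_isIntegral_of_isMaximal M
  have hle : (maximalIdeal B).map (AdjoinRoot.of P) ≤ M := by
    rw [← IsLocalRing.eq_maximalIdeal hc, Ideal.map_le_iff_le_comap, AdjoinRoot.algebraMap_eq]
  exact (hmax.eq_of_le hM.ne_top hle).symm

/-- Under the same hypotheses the maximal ideal of `B[T]/(P)` is `𝔪_B · B[T]/(P)`. [folklore] -/
theorem maximalIdeal_adjoinRoot (hP : P.Monic) (hirr : Irreducible (P.map (residue B))) :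
    letI := isLocalRing_adjoinRoot P hP hirr
    maximalIdeal (AdjoinRoot P) = (maximalIdeal B).map (AdjoinRoot.of P) := by
  letI := isLocalRing_adjoinRoot P hP hirr
  exact (IsLocalRing.eq_maximalIdeal (isMaximal_map_maximalIdeal_adjoinRoot P hirr)).symm

omit [IsLocalRing B] in
/-- `B → B[T]/(P)` is flat for `P` monic (`B[T]/(P)` is free with basis `1, T, …, T^{deg P - 1}`,
Mathlib `AdjoinRoot.powerBasis'`). [folklore] -/
theorem flat_of_adjoinRoot (hP : P.Monic) : (AdjoinRoot.of P).Flat := by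
  haveI : Module.Free B (AdjoinRoot P) := Module.Free.of_basis (AdjoinRoot.powerBasis' hP).basis
  rw [← AdjoinRoot.algebraMap_eq, RingHom.flat_algebraMap_iff]
  infer_instance

/-- A ring map from a local ring to a field is a local homomorphism iff it kills the maximal
ideal; in that case `B → B[T]/(P) → K`, `T ↦ a` (for a root `a` of `P` in `K`) is again a local
homomorphism of the local ring `B[T]/(P)`. [folklore] -/
theorem isLocalHom_of_maximalIdeal_le {K : Type*} [Field K] (ψ : B →+* K)
    (h : maximalIdeal B ≤ RingHom.ker ψ) : IsLocalHom ψ := by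
  refine ⟨fun a ha ↦ ?_⟩
  by_contra hna
  have : ψ a = 0 := h ((mem_maximalIdeal _).mpr hna)
  exact ha.ne_zero this

/-- Conversely a local homomorphism to a field kills the maximal ideal. [folklore] -/
theorem maximalIdeal_le_ker {K : Type*} [Field K] (ψ : B →+* K) [IsLocalHom ψ] :
    maximalIdeal B ≤ RingHom.ker ψ := by
  intro a ha
  rw [RingHom.mem_ker]
  by_contra hne
  exact (mem_maximalIdeal _).mp ha (IsUnit.of_map ψ _ (Ne.isUnit hne))

/-- The extension `ψ₁ : B[T]/(P) → K`, `T ↦ a`, of a local homomorphism `ψ : B → K` to a field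
along a root `a ∈ K` of `P`, is a local homomorphism (for `P` monic with irreducible reduction,
so that `B[T]/(P)` is local with maximal ideal generated by `𝔪_B`). [folklore] -/
theorem isLocalHom_lift (hP : P.Monic) (hirr : Irreducible (P.map (residue B))) {K : Type u}
    [Field K] (ψ : B →+* K) [IsLocalHom ψ] (a : K) (ha : P.eval₂ ψ a = 0) :
    letI := isLocalRing_adjoinRoot P hP hirr
    IsLocalHom (AdjoinRoot.lift ψ a ha) := by
  letI := isLocalRing_adjoinRoot P hP hirr
  refine isLocalHom_of_maximalIdeal_le _ ?_
  rw [maximalIdeal_adjoinRoot P hP hirr, Ideal.map_le_iff_le_comap]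
  intro b hb
  rw [Ideal.mem_comap, RingHom.mem_ker, AdjoinRoot.lift_of]
  exact maximalIdeal_le_ker ψ hb

end AdjoinRoot

/-! ### Pasting of affine base changes -/

/-- `(Y ×_B B') ×_{B'} B'' ≅ Y ×_B B''` for ring maps `B → B' → B''` (pullback pasting); in
particular the two have the same connectedness. [folklore] -/
theorem connectedSpace_pullback_comp_iff {B B' B'' : Type u} [CommRing B] [CommRing B']
    [CommRing B''] {Y : Scheme.{u}} (g : Y ⟶ Spec (.of B)) (φ : B →+* B') (χ : B' →+* B'') :
    ConnectedSpace
      ↥(pullback (pullback.snd g (Spec.map (CommRingCat.ofHom φ))) (Spec.map (CommRingCat.ofHom χ))) ↔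
      ConnectedSpace ↥(pullback g (Spec.map (CommRingCat.ofHom (χ.comp φ)))) := by
  let e : pullback (pullback.snd g (Spec.map (CommRingCat.ofHom φ))) (Spec.map (CommRingCat.ofHom χ)) ≅
      pullback g (Spec.map (CommRingCat.ofHom (χ.comp φ))) :=
    pullbackLeftPullbackSndIso g (Spec.map (CommRingCat.ofHom φ)) (Spec.map (CommRingCat.ofHom χ)) ≪≫
      pullback.congrHom rfl (by rw [← Spec.map_comp, ← CommRingCat.ofHom_comp])
  exact ⟨fun _ ↦ connectedSpace_of_iso e, fun _ ↦ connectedSpace_of_iso e.symm⟩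

/-- Base change along an isomorphism of rings does not change the scheme: `Y ×_B B' ≅ Y` over
`Spec B' ≅ Spec B`; in particular connectedness is preserved. [folklore] -/
theorem connectedSpace_pullback_of_bijective {B B' : Type u} [CommRing B] [CommRing B']
    {Y : Scheme.{u}} (g : Y ⟶ Spec (.of B)) (φ : B →+* B') (hφ : Function.Bijective φ)
    [ConnectedSpace Y] : ConnectedSpace ↥(pullback g (Spec.map (CommRingCat.ofHom φ))) := by
  haveI : IsIso (CommRingCat.ofHom φ) :=
    (ConcreteCategory.isIso_iff_bijective (CommRingCat.ofHom φ)).mpr hφ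
  haveI : IsIso (pullback.fst g (Spec.map (CommRingCat.ofHom φ))) := inferInstance
  exact connectedSpace_of_iso (asIso (pullback.fst g (Spec.map (CommRingCat.ofHom φ)))).symm

/-! ### The closed fibre: non-emptiness, closed points -/

section ClosedFibre

open IsLocalRing

variable {B : Type u} [CommRing B] [IsLocalRing B] {Y : Scheme.{u}} (g : Y ⟶ Spec (.of B))

/-- The closed fibre `Y ×_B κ_B` of a universally closed `g : Y → Spec B`, `B` local, with
`Γ(Y, 𝒪_Y) ≅ B` is non-empty: `Y ≠ ∅` (its ring of functions is the non-zero ring `B`) and the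
image of `g` is closed and non-empty, so it contains the closed point. [folklore] -/
theorem nonempty_closedFibre [UniversallyClosed g] [IsIso g.appTop] :
    Nonempty ↥(pullback g (Spec.map (CommRingCat.ofHom (residue B)))) := by
  -- `Y` is non-empty
  have eB : B ≃+* Γ(Y, ⊤) :=
    (Scheme.ΓSpecIso (.of B)).symm.commRingCatIsoToRingEquiv.trans
      (asIso g.appTop).commRingCatIsoToRingEquiv
  haveI : Nontrivial Γ(Y, ⊤) := eB.injective.nontrivial
  have hY : Nonempty Y := by
    by_contra h
    rw [not_nonempty_iff] at h
    haveI : Subsingleton Γ(Y, ⊤) :=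
      CommRingCat.subsingleton_of_isTerminal (Y.sheaf.isTerminalOfEqEmpty (by
        ext x; exact (IsEmpty.false x).elim))
    exact false_of_nontrivial_of_subsingleton Γ(Y, ⊤)
  obtain ⟨y⟩ := hY
  -- the image of `g` is closed, non-empty, hence contains the closed point
  have hcl : IsClosed (Set.range g) := g.isClosedMap.isClosed_range
  have hmem : closedPoint B ∈ Set.range g := by
    have hspec : closedPoint B ∈ closure {g y} :=
      (IsLocalRing.specializes_closedPoint (g y)).mem_closure
    exact hcl.closure_subset_iff.mpr (Set.singleton_subset_iff.mpr ⟨y, rfl⟩) hspec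
  obtain ⟨y', hy'⟩ := hmem
  -- so the fibre over the closed point is non-empty
  have hpt : (Spec.map (CommRingCat.ofHom (residue B))) (closedPoint (ResidueField B)) =
      closedPoint B := by
    rw [Spec.map_apply, CommRingCat.hom_ofHom]
    exact IsLocalRing.PrimeSpectrum.comap_residue B _
  obtain ⟨z, -, -⟩ := Scheme.Pullback.exists_preimage_pullback (f := g)
    (g := Spec.map (CommRingCat.ofHom (residue B))) y' (closedPoint (ResidueField B))
    (hy'.trans hpt.symm)
  exact ⟨z⟩

omit [IsLocalRing B] in
/-- A non-empty scheme locally of finite type over a field has a closed point, and the residue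
field of a closed point is a finite extension of the base field (schemes locally of finite
type over a field are Jacobson; Mathlib `isFinite_iff_locallyOfFiniteType_of_jacobsonSpace`).
[folklore] -/
theorem exists_isClosed_and_isFinite {k : Type u} [Field k] {T : Scheme.{u}}
    (q : T ⟶ Spec (.of k)) [LocallyOfFiniteType q] [Nonempty T] :
    ∃ x : T, IsClosed ({x} : Set T) ∧ IsFinite (T.fromSpecResidueField x ≫ q) := by
  haveI : JacobsonSpace T := LocallyOfFiniteType.jacobsonSpace q
  have hne : (closedPoints T).Nonempty := by
    by_contra h
    rw [Set.not_nonempty_iff_eq_empty] at h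
    have := closure_closedPoints (X := T)
    rw [h, closure_empty] at this
    exact Set.empty_ne_univ this
  obtain ⟨x, hx⟩ := hne
  refine ⟨x, hx, ?_⟩
  have hx' : IsClosedImmersion (T.fromSpecResidueField x) :=
    isClosed_singleton_iff_isClosedImmersion.mp hx
  rw [isFinite_iff_locallyOfFiniteType_of_jacobsonSpace]
  infer_instance

end ClosedFibre

/-! ### The hypotheses of the local criterion

The criterion is parametrised by a class `𝒩` of commutative rings stable under `B ↦ B[T]/(P)`
(`P` monic) and under localisation at primes (e.g. all rings; Noetherian rings), a class `𝒞` of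
morphisms to affine schemes stable under affine base change (e.g. all; projective), and the
**local connectedness core** for them (`hConn`): for `B ∈ 𝒩` local and `g : Y → Spec B` proper in
`𝒞` with `B ≅ Γ(Y, 𝒪_Y)`, the closed fibre `Y ×_B κ_B` is preconnected — the consequence of Stacks
Project, Tag 0G7X used in the proof of Tag 03H2. -/

section Criterion

variable {𝒩 : ∀ (B : Type u) [CommRing B], Prop}
  {𝒞 : ∀ ⦃B : Type u⦄ [CommRing B] ⦃Y : Scheme.{u}⦄, (Y ⟶ Spec (.of B)) → Prop}
  (h𝒩 : ∀ (B : Type u) [CommRing B] (P : Polynomial B), P.Monic → 𝒩 B → 𝒩 (AdjoinRoot P))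
  (h𝒩' : ∀ (B : Type u) [CommRing B] (𝔭 : Ideal B) [𝔭.IsPrime], 𝒩 B →
    𝒩 (Localization.AtPrime 𝔭))
  (h𝒞 : ∀ ⦃B B' : Type u⦄ [CommRing B] [CommRing B'] (φ : B →+* B') ⦃Y : Scheme.{u}⦄
    (g : Y ⟶ Spec (.of B)), 𝒞 g → 𝒞 (pullback.snd g (Spec.map (CommRingCat.ofHom φ))))
  (hConn : ∀ (B : Type u) [CommRing B] [IsLocalRing B], 𝒩 B → ∀ ⦃Y : Scheme.{u}⦄
    (g : Y ⟶ Spec (.of B)) [IsProper g], 𝒞 g → IsIso g.appTop →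
      PreconnectedSpace ↥(pullback g (Spec.map (CommRingCat.ofHom (IsLocalRing.residue B)))))

/-! ### Finite residue field extensions: induction on the degree -/

section Induction

open IsLocalRing Polynomial

include h𝒩 h𝒞 hConn in
/-- **Connectedness of `Y ×_B K` for finite residue extensions `K/κ_B`**, by induction on
`[K : κ_B]`. Let `B ∈ 𝒩` be local, `g : Y → Spec B` proper in `𝒞` with `B ≅ Γ(Y, 𝒪_Y)`, and
`ψ : B → K` a local homomorphism to a field with `K` finite over `κ_B`. If `κ_B → K` is onto,
`Y ×_B K ≅ Y ×_B κ_B` is connected by the local core. Otherwise pick `a ∈ K ∖ κ_B` with minimal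
polynomial `p`, lift it to a monic `P ∈ B[T]`; then `B₁ = B[T]/(P) ∈ 𝒩` is local, finite free
over `B`, with residue field `κ_B[T]/(p) ∋ a`, `ψ` extends to a local `ψ₁ : B₁ → K` (`T ↦ a`),
`Y₁ = Y ×_B B₁ → Spec B₁` is proper, in `𝒞`, with `B₁ ≅ Γ(Y₁, 𝒪)` by flat base change, and
`[K : κ_{B₁}] ≤ [K : κ_B] / 2`; since `Y₁ ×_{B₁} K = Y ×_B K` the induction hypothesis applies.
(This replaces the étale-neighbourhood argument, Tags 03GZ/02LF/0389, of the printed proof of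
Tag 03H2 by finite free base changes.) [cite: StacksProject, Tag 03H2 (More on Morphisms, Theorem 37.53.5, proof)] -/
theorem connectedSpace_pullback_of_finite (n : ℕ) :
    ∀ (B : Type u) [CommRing B] [IsLocalRing B], 𝒩 B →
    ∀ ⦃Y : Scheme.{u}⦄ (g : Y ⟶ Spec (.of B)) [IsProper g], 𝒞 g → IsIso g.appTop →
    ∀ (K : Type u) [Field K] (ψ : B →+* K) [IsLocalHom ψ],
      (ResidueField.lift ψ).Finite →
      (letI := (ResidueField.lift ψ).toAlgebra
       Module.finrank (ResidueField B) K) ≤ n →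
      ConnectedSpace ↥(pullback g (Spec.map (CommRingCat.ofHom ψ))) := by
  induction n with
  | zero =>
    intro B _ _ hB Y g _ hg hiso K _ ψ _ hfin hn
    exfalso
    letI := (ResidueField.lift ψ).toAlgebra
    haveI : Module.Finite (ResidueField B) K := hfin
    have := Module.finrank_pos (R := ResidueField B) (M := K)
    omega
  | succ n ih =>
    intro B _ _ hB Y g _ hg hiso K _ ψ _ hfin hn
    -- notation
    set k := ResidueField B with hk
    set ψ' := ResidueField.lift ψ with hψ'
    letI : Algebra k K := ψ'.toAlgebra
    haveI : Module.Finite k K := hfin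
    have hn' : Module.finrank k K ≤ n + 1 := hn
    haveI : CompactSpace Y := QuasiCompact.compactSpace_of_compactSpace g
    haveI : QuasiSeparatedSpace Y := quasiSeparatedSpace_of_quasiSeparated g
    have hψfac : ψ'.comp (residue B) = ψ := ResidueField.lift_comp_residue ψ
    by_cases hsurj : Function.Surjective ψ'
    · -- base case: `K = κ_B`
      haveI := hConn B hB g hg hiso
      haveI := nonempty_closedFibre g
      haveI : ConnectedSpace ↥(pullback g (Spec.map (CommRingCat.ofHom (residue B)))) :=
        { toNonempty := inferInstance }
      haveI := connectedSpace_pullback_of_bijective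
        (pullback.snd g (Spec.map (CommRingCat.ofHom (residue B)))) ψ' ⟨ψ'.injective, hsurj⟩
      rw [← hψfac]
      exact (connectedSpace_pullback_comp_iff g (residue B) ψ').mp inferInstance
    · -- induction step
      obtain ⟨a, ha⟩ : ∃ a : K, a ∉ Set.range ψ' := by
        by_contra h
        exact hsurj fun y ↦ not_not.mp (not_exists.mp h y)
      have hint : IsIntegral k a := Algebra.IsIntegral.isIntegral a
      have hpmonic : (minpoly k a).Monic := minpoly.monic hint
      have hpirr : Irreducible (minpoly k a) := minpoly.irreducible hint
      obtain ⟨P, hPp, -, hPmonic⟩ := Polynomial.lifts_and_natDegree_eq_and_monic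
        ((Polynomial.mem_lifts _).mpr (Polynomial.map_surjective (residue B) residue_surjective
          (minpoly k a))) hpmonic
      have hirr : Irreducible (P.map (residue B)) := by rwa [hPp]
      letI : IsLocalRing (AdjoinRoot P) := isLocalRing_adjoinRoot P hPmonic hirr
      have ha0 : P.eval₂ ψ a = 0 := by
        rw [← hψfac, ← Polynomial.eval₂_map, hPp]
        exact minpoly.aeval k a
      set ψ₁ : AdjoinRoot P →+* K := AdjoinRoot.lift ψ a ha0 with hψ₁
      haveI : IsLocalHom ψ₁ := isLocalHom_lift P hPmonic hirr ψ a ha0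
      have hψ₁ψ : ψ₁.comp (AdjoinRoot.of P) = ψ := AdjoinRoot.lift_comp_of ha0
      -- the new data `(B₁, g₁, ψ₁)`
      have hB₁ : 𝒩 (AdjoinRoot P) := h𝒩 B P hPmonic hB
      set g₁ := pullback.snd g (Spec.map (CommRingCat.ofHom (AdjoinRoot.of P))) with hg₁
      have h𝒞₁ : 𝒞 g₁ := h𝒞 _ g hg
      haveI hiso₁ : IsIso g₁.appTop :=
        isIso_appTop_pullback_snd_of_flat g (AdjoinRoot.of P) (flat_of_adjoinRoot P hPmonic)
      -- residue fields: `k → k₁ → K`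
      haveI : IsLocalHom (algebraMap B (AdjoinRoot P)) := by
        rw [AdjoinRoot.algebraMap_eq]
        exact ((IsLocalRing.local_hom_TFAE (AdjoinRoot.of P)).out 2 0).mp
          (le_of_eq (maximalIdeal_adjoinRoot P hPmonic hirr).symm)
      set k₁ := ResidueField (AdjoinRoot P) with hk₁
      set ψ₁' := ResidueField.lift ψ₁ with hψ₁'
      letI : Algebra k₁ K := ψ₁'.toAlgebra
      haveI : IsScalarTower k k₁ K := by
        refine IsScalarTower.of_algebraMap_eq fun x ↦ ?_
        obtain ⟨b, rfl⟩ := residue_surjective x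
        change ψ' (residue B b) = ψ₁' (algebraMap k k₁ (residue B b))
        rw [ResidueField.algebraMap_residue, ResidueField.lift_residue_apply,
          ResidueField.lift_residue_apply, AdjoinRoot.algebraMap_eq]
        exact (AdjoinRoot.lift_of ha0 (x := b)).symm
      haveI : Module.Finite B (AdjoinRoot P) := (AdjoinRoot.powerBasis' hPmonic).finite
      haveI : Module.Finite k k₁ := inferInstance
      haveI : Module.Finite k₁ K := Module.Finite.of_restrictScalars_finite k k₁ K
      have hfin₁ : ψ₁'.Finite := ‹Module.Finite k₁ K›
      -- degrees
      have hne : Module.finrank k k₁ ≠ 1 := by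
        intro h1
        have hb := (Algebra.finrank_eq_one_iff_bijective_algebraMap).mp h1
        obtain ⟨c, hc⟩ := hb.2 (residue (AdjoinRoot P) (AdjoinRoot.root P))
        refine ha ⟨c, ?_⟩
        change algebraMap k K c = a
        rw [IsScalarTower.algebraMap_apply k k₁ K c, hc]
        change ψ₁' (residue (AdjoinRoot P) (AdjoinRoot.root P)) = a
        rw [ResidueField.lift_residue_apply]
        exact AdjoinRoot.lift_root ha0
      have hpos₁ : 0 < Module.finrank k k₁ := Module.finrank_pos
      have hposK : 0 < Module.finrank k₁ K := Module.finrank_pos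
      have htower := Module.finrank_mul_finrank k k₁ K
      have hn₁ : Module.finrank k₁ K ≤ n := by
        have h2 : 2 * Module.finrank k₁ K ≤ Module.finrank k K := by
          rw [← htower]
          exact Nat.mul_le_mul_right _ (by omega)
        clear hn
        omega
      -- induction hypothesis for `(B₁, g₁, ψ₁)`, and `Y₁ ×_{B₁} K = Y ×_B K`
      haveI := ih (AdjoinRoot P) hB₁ g₁ h𝒞₁ hiso₁ K ψ₁ hfin₁ hn₁
      rw [← hψ₁ψ]
      exact (connectedSpace_pullback_comp_iff g (AdjoinRoot.of P) ψ₁).mp inferInstance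

end Induction

/-! ### The closed fibre is geometrically connected -/

section Local

open IsLocalRing

include h𝒩 h𝒞 hConn in
/-- **The closed fibre is geometrically connected.** For `B ∈ 𝒩` local and `g : Y → Spec B`
proper in `𝒞` with `B ≅ Γ(Y, 𝒪_Y)`, the closed fibre `Y₀ = Y ×_B κ_B → Spec κ_B` is geometrically
connected: it is non-empty and of finite type, so it has a closed point `x` with `κ(x)/κ_B`
finite; `Y₀ ⊗ κ(x)` is connected (`connectedSpace_pullback_of_finite`) and has a rational point,
hence is geometrically connected over `κ(x)` (Stacks Project, Tag 04KV, the tree's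
`geometricallyConnected_of_section`), and geometric connectedness descends from `κ(x)` to
`κ_B`. [cite: StacksProject, Tag 03H2 (More on Morphisms, Theorem 37.53.5, proof) with Tag 04KV (Varieties, Lemma 33.7.14)] -/
theorem geometricallyConnected_closedFibre (B : Type u)
    [CommRing B] [IsLocalRing B] (hB : 𝒩 B) {Y : Scheme.{u}} (g : Y ⟶ Spec (.of B)) [IsProper g]
    (hg : 𝒞 g) [IsIso g.appTop] :
    GeometricallyConnected (pullback.snd g (Spec.map (CommRingCat.ofHom (residue B)))) := by
  haveI : Nonempty ↥(pullback g (Spec.map (CommRingCat.ofHom (residue B)))) :=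
    nonempty_closedFibre g
  -- a closed point `x` of the closed fibre `T`, with finite residue field extension
  obtain ⟨x, -, hfin⟩ :=
    exists_isClosed_and_isFinite (pullback.snd g (Spec.map (CommRingCat.ofHom (residue B))))
  obtain ⟨φ₀, hy⟩ : ∃ φ₀ : ResidueField B →+*
      (pullback g (Spec.map (CommRingCat.ofHom (residue B)))).residueField x,
      Spec.map (CommRingCat.ofHom φ₀) =
        (pullback g (Spec.map (CommRingCat.ofHom (residue B)))).fromSpecResidueField x ≫
          pullback.snd g (Spec.map (CommRingCat.ofHom (residue B))) :=
    ⟨(Spec.preimage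
        ((pullback g (Spec.map (CommRingCat.ofHom (residue B)))).fromSpecResidueField x ≫
          pullback.snd g (Spec.map (CommRingCat.ofHom (residue B))))).hom,
      by rw [CommRingCat.ofHom_hom, Spec.map_preimage]⟩
  haveI : IsLocalHom (φ₀.comp (residue B)) :=
    isLocalHom_of_maximalIdeal_le _ fun b hb ↦ by
      rw [RingHom.mem_ker, RingHom.comp_apply, (residue_eq_zero_iff b).mpr hb, map_zero]
  have hlift : ResidueField.lift (φ₀.comp (residue B)) = φ₀ :=
    Ideal.Quotient.ringHom_ext (ResidueField.lift_comp_residue _)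
  have hψfin : (ResidueField.lift (φ₀.comp (residue B))).Finite := by
    rw [hlift]
    have : IsFinite (Spec.map (CommRingCat.ofHom φ₀)) := by rwa [hy]
    exact (IsFinite.SpecMap_iff (CommRingCat.ofHom φ₀)).mp this
  -- `Y₀ ⊗ κ(x)` is connected
  haveI hconn := connectedSpace_pullback_of_finite h𝒩 h𝒞 hConn _ B hB g hg inferInstance _
    (φ₀.comp (residue B)) hψfin le_rfl
  haveI : ConnectedSpace ↥(pullback (pullback.snd g (Spec.map (CommRingCat.ofHom (residue B))))
      (Spec.map (CommRingCat.ofHom φ₀))) :=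
    (connectedSpace_pullback_comp_iff g (residue B) φ₀).mpr hconn
  -- it has a rational point, hence is geometrically connected (Tag 04KV); descend to `κ_B`
  have hs : pullback.lift ((pullback g (Spec.map (CommRingCat.ofHom (residue B)))).fromSpecResidueField x)
      (𝟙 _) (by rw [← hy, Category.id_comp]) ≫
        pullback.snd (pullback.snd g (Spec.map (CommRingCat.ofHom (residue B))))
          (Spec.map (CommRingCat.ofHom φ₀)) = 𝟙 _ :=
    pullback.lift_snd _ _ _
  haveI : QuasiSeparatedSpace ↥(pullback (pullback.snd g (Spec.map (CommRingCat.ofHom (residue B))))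
      (Spec.map (CommRingCat.ofHom φ₀))) :=
    quasiSeparatedSpace_of_quasiSeparated (pullback.snd _ (Spec.map (CommRingCat.ofHom φ₀)))
  exact geometricallyConnected_of_geometricallyConnected_baseChange _ φ₀
    (geometricallyConnected_of_section _ _ hs)

include h𝒩 h𝒞 hConn in
/-- **Connectedness of `Y ×_B K` for every local homomorphism `B → K` to a field** (not only
finite residue extensions): by the geometric connectedness of the closed fibre. [cite: StacksProject, Tag 03H2 (More on Morphisms, Theorem 37.53.5 (1))] -/
theorem connectedSpace_pullback_of_isLocalHom (B : Type u)
    [CommRing B] [IsLocalRing B] (hB : 𝒩 B) {Y : Scheme.{u}} (g : Y ⟶ Spec (.of B)) [IsProper g]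
    (hg : 𝒞 g) [IsIso g.appTop] (K : Type u) [Field K] (ψ : B →+* K) [IsLocalHom ψ] :
    ConnectedSpace ↥(pullback g (Spec.map (CommRingCat.ofHom ψ))) := by
  have hgc := geometricallyConnected_closedFibre h𝒩 h𝒞 hConn B hB g hg
  haveI := pullback_of_geometrically hgc.geometrically_connectedSpace K
    (Spec.map (CommRingCat.ofHom (ResidueField.lift ψ)))
  have h := (connectedSpace_pullback_comp_iff g (residue B) (ResidueField.lift ψ)).mp inferInstance
  rwa [ResidueField.lift_comp_residue] at h

end Local

/-! ### The global statement -/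

include h𝒩 h𝒩' h𝒞 hConn in
/-- **Local connectedness core ⇒ geometrically connected fibres.** For `B ∈ 𝒩` and
`g : Y → Spec B` proper in `𝒞` with `B ≅ Γ(Y, 𝒪_Y)`, `g` is geometrically connected: a morphism
`Spec K → Spec B` factors as `B → B_𝔭 → K` with `B_𝔭 → K` local; `Y_𝔭 = Y ×_B B_𝔭 → Spec B_𝔭`
is proper, in `𝒞`, with `B_𝔭 ≅ Γ(Y_𝔭, 𝒪)` by flat base change (Stacks Project, Tag 02KH), so
`Y ×_B K = Y_𝔭 ×_{B_𝔭} K` is connected by `connectedSpace_pullback_of_isLocalHom`. This is the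
passage "we may assume `S = Spec R` affine … replace `S` by `S'` … `R = Γ(X, 𝒪_X)` … for every
`s ∈ S`" of the printed proof of Tag 03H2. [cite: StacksProject, Tag 03H2 (More on Morphisms, Theorem 37.53.5, proof)] -/
theorem geometricallyConnected_of_localConn {B : Type u}
    [CommRing B] (hB : 𝒩 B) {Y : Scheme.{u}} (g : Y ⟶ Spec (.of B)) [IsProper g] (hg : 𝒞 g)
    [IsIso g.appTop] : GeometricallyConnected g := by
  haveI : CompactSpace Y := QuasiCompact.compactSpace_of_compactSpace g
  haveI : QuasiSeparatedSpace Y := quasiSeparatedSpace_of_quasiSeparated g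
  refine ⟨(geometrically_iff_of_commRing_of_isClosedUnderIsomorphisms
    (P := fun X : Scheme.{u} ↦ ConnectedSpace X)).mpr fun K _ _ ↦ ?_⟩
  set φ := algebraMap B K with hφ
  set 𝔭 := RingHom.ker φ with h𝔭
  haveI : 𝔭.IsPrime := RingHom.ker_isPrime φ
  have hunit : ∀ s : 𝔭.primeCompl, IsUnit (φ s) := fun s ↦
    Ne.isUnit fun h0 ↦ s.2 (RingHom.mem_ker.mpr h0)
  set φ' : Localization.AtPrime 𝔭 →+* K := IsLocalization.lift hunit with hφ'
  have hφ'c : φ'.comp (algebraMap B (Localization.AtPrime 𝔭)) = φ := IsLocalization.lift_comp hunit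
  haveI : IsLocalHom φ' := by
    refine isLocalHom_of_maximalIdeal_le φ' ?_
    rw [← Localization.AtPrime.map_eq_maximalIdeal, Ideal.map_le_iff_le_comap]
    intro b hb
    rw [Ideal.mem_comap, RingHom.mem_ker, ← RingHom.comp_apply, hφ'c]
    exact hb
  -- the localised data
  set g' := pullback.snd g (Spec.map (CommRingCat.ofHom (algebraMap B (Localization.AtPrime 𝔭))))
    with hg'
  have h𝒞' : 𝒞 g' := h𝒞 _ g hg
  haveI : IsIso g'.appTop := isIso_appTop_pullback_snd_of_flat g _
    (RingHom.flat_algebraMap_iff.mpr (IsLocalization.flat (Localization.AtPrime 𝔭) 𝔭.primeCompl))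
  have hB' : 𝒩 (Localization.AtPrime 𝔭) := h𝒩' B 𝔭 hB
  haveI := connectedSpace_pullback_of_isLocalHom h𝒩 h𝒞 hConn (Localization.AtPrime 𝔭) hB' g'
    h𝒞' K φ'
  have h := (connectedSpace_pullback_comp_iff g (algebraMap B (Localization.AtPrime 𝔭)) φ').mp
    inferInstance
  rwa [hφ'c] at h

end Criterion

end SteinFibre

/-! ## Specialisation to the named fact: Tag 03H2 (1) from the local connectedness core -/

open SteinFibre IsLocalRing in
/-- **Geometrically connected fibres over an affine base from the local connectedness core.**
If for every local ring `B` and every proper `g : Y → Spec B` with `B ≅ Γ(Y, 𝒪_Y)` the closed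
fibre `Y ×_B κ_B` is preconnected (the consequence of Stacks Project, Tag 0G7X used in the
proof of Tag 03H2), then every proper `g : Y → Spec B` (any ring `B`) with `B ≅ Γ(Y, 𝒪_Y)` is
geometrically connected. [cite: StacksProject, Tag 03H2 (More on Morphisms, Theorem 37.53.5, proof)] -/
theorem geometricallyConnected_of_isIso_appTop_of_localConn
    (hConn : ∀ (B : Type u) [CommRing B] [IsLocalRing B] ⦃Y : Scheme.{u}⦄ (g : Y ⟶ Spec (.of B))
      [IsProper g], IsIso g.appTop →
        PreconnectedSpace ↥(pullback g (Spec.map (CommRingCat.ofHom (residue B)))))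
    {B : Type u} [CommRing B] {Y : Scheme.{u}} (g : Y ⟶ Spec (.of B)) [IsProper g]
    [IsIso g.appTop] : GeometricallyConnected g :=
  geometricallyConnected_of_localConn (𝒩 := fun _ _ ↦ True) (𝒞 := fun _ _ _ _ ↦ True)
    (fun _ _ _ _ _ ↦ trivial) (fun _ _ _ _ _ ↦ trivial) (fun _ _ _ _ _ _ _ _ ↦ trivial)
    (fun B _ _ _ _ g _ _ hiso ↦ hConn B g hiso) trivial g trivial

open SteinFibre IsLocalRing in
/-- **Stacks Project, Tag 03H2 (1) from the local connectedness core (Tag 0G7X).** If for every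
local ring `B` and every proper `g : Y → Spec B` with `B ≅ Γ(Y, 𝒪_Y)` the closed fibre is
preconnected, then for every proper `f : X → S` the morphism `f' : X → S'` to the normalisation
of `S` in `X` has geometrically connected fibres (the named fact
`steinFactorization_geometricallyConnected`). Proof, as printed: the question is local on `S'`;
over an affine open `U ⊆ S`, `π⁻¹U = Spec B` with `B = Γ(f⁻¹U, 𝒪_X)`
(`isIso_toNormalization_app`, Tag 03GY (3)–(4)) and `f'` restricts to the proper morphism
`f⁻¹U → Spec B` (`isProper_toNormalization`), to which
`geometricallyConnected_of_isIso_appTop_of_localConn` applies.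
[cite: StacksProject, Tag 03H2 (More on Morphisms, Theorem 37.53.5 (1), proof)] -/
theorem steinFactorization_geometricallyConnected_of_localConn
    (hConn : ∀ (B : Type u) [CommRing B] [IsLocalRing B] ⦃Y : Scheme.{u}⦄ (g : Y ⟶ Spec (.of B))
      [IsProper g], IsIso g.appTop →
        PreconnectedSpace ↥(pullback g (Spec.map (CommRingCat.ofHom (residue B))))) :
    steinFactorization_geometricallyConnected.{u} := by
  intro X S f _
  haveI := isProper_toNormalization f
  haveI : IsZariskiLocalAtTarget @GeometricallyConnected :=
    GeometricallyConnected.eq_geometrically ▸ inferInstance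
  apply IsZariskiLocalAtTarget.of_forall_exists_morphismRestrict (P := @GeometricallyConnected)
  intro s'
  obtain ⟨_, ⟨U, hU, rfl⟩, hsU, -⟩ :=
    S.isBasis_affineOpens.exists_subset_of_mem_open (Set.mem_univ (f.fromNormalization s'))
      isOpen_univ
  refine ⟨f.fromNormalization ⁻¹ᵁ U, hsU, ?_⟩
  -- `V = π⁻¹ U` is affine, `f'⁻¹V → V` is proper and `Γ(V) ≅ Γ(f'⁻¹ V)` (Tag 03GY (3)–(4))
  haveI : IsAffine (↑(f.fromNormalization ⁻¹ᵁ U) : Scheme.{u}) := hU.preimage f.fromNormalization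
  haveI : IsProper (f.toNormalization ∣_ f.fromNormalization ⁻¹ᵁ U) :=
    MorphismProperty.of_isPullback (isPullback_morphismRestrict ..).flip ‹_›
  have h1 : IsIso (f.toNormalization.app ((f.fromNormalization ⁻¹ᵁ U).ι ''ᵁ ⊤)) := by
    rw [Scheme.Opens.ι_image_top]; exact isIso_toNormalization_app f ⟨U, hU⟩
  have h2 : IsIso (f.toNormalization ∣_ f.fromNormalization ⁻¹ᵁ U).appTop := by
    rw [morphismRestrict_appTop]
    exact IsIso.comp_isIso' h1 (Functor.map_isIso X.presheaf _)
  have h3 : IsIso ((↑(f.fromNormalization ⁻¹ᵁ U) : Scheme.{u}).isoSpec.hom).appTop := by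
    show IsIso (((↑(f.fromNormalization ⁻¹ᵁ U) : Scheme.{u}).isoSpec.hom).app ⊤)
    infer_instance
  -- the proper morphism `g : f'⁻¹V → V ≅ Spec Γ(V)` is geometrically connected
  let g : (↑(f.toNormalization ⁻¹ᵁ (f.fromNormalization ⁻¹ᵁ U)) : Scheme.{u}) ⟶
      Spec (CommRingCat.of Γ(↑(f.fromNormalization ⁻¹ᵁ U), ⊤)) :=
    (f.toNormalization ∣_ f.fromNormalization ⁻¹ᵁ U) ≫
      (↑(f.fromNormalization ⁻¹ᵁ U) : Scheme.{u}).isoSpec.hom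
  have hgP : IsProper g :=
    inferInstanceAs (IsProper ((f.toNormalization ∣_ f.fromNormalization ⁻¹ᵁ U) ≫
      (↑(f.fromNormalization ⁻¹ᵁ U) : Scheme.{u}).isoSpec.hom))
  have hgI : IsIso g.appTop := by
    show IsIso ((f.toNormalization ∣_ f.fromNormalization ⁻¹ᵁ U) ≫
      (↑(f.fromNormalization ⁻¹ᵁ U) : Scheme.{u}).isoSpec.hom).appTop
    rw [Scheme.Hom.comp_appTop]; exact IsIso.comp_isIso' h3 h2
  have hgc : GeometricallyConnected g :=
    @geometricallyConnected_of_isIso_appTop_of_localConn hConn _ _ _ g hgP hgI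
  have e : f.toNormalization ∣_ f.fromNormalization ⁻¹ᵁ U =
      g ≫ (↑(f.fromNormalization ⁻¹ᵁ U) : Scheme.{u}).isoSpec.inv := by
    simp only [g, Category.assoc, Iso.hom_inv_id, Category.comp_id]
  rw [e]
  exact MorphismProperty.RespectsIso.postcomp (P := @GeometricallyConnected) _ _ hgc

end Literature.AlgebraicGeometry.Morphisms

end
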